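import Summits.RiemannHypothesis.RiemannHypothesis.Theorems.GroundBartaEvenWinsBeyondArchDeflationIncrements
import HarnessLib

/-!
# RiemannHypothesis / GroundBarta — rung 4 (`EvenWinsBeyondArch`, stmt-RiemannHypothesis-18807):
# the deflated Temple (Lehmann–Maehly) L-side programme, Ib — pole form, real pairing and the closed form on the window form domain

Helper file (`--supports stmt-RiemannHypothesis-18807`), RH-free, Mathlib + landed tree files only, no
definitions, no named facts.

The RH-free residue of rung 4 is the parity ladder of certified window cells (`ε_ev < ε_od` cell by cell,
item stmt-RiemannHypothesis-18085 / 18807); its L-sides (certified LOWER bounds for the sector bottoms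
`ε_od(c) = weilOddGroundEnergy c`, `ε_ev(c) = weilEvenGroundEnergy c`) are so far Yoshida moment certificates,
whose T-tail undercount is a precision wall at `c ≈ 0.75` (FEASIBILITY-234 on 18085/18807).  The way round it
is the DEFLATED TEMPLE / LEHMANN–MAEHLY INCLUSION (abstract lemma
`Literature.Analysis.OperatorTheory.deflatedFormBound_of_decomp`, p179129): explicit Ritz data `v₁ … v_k`
with window residuals, plus a LOW-precision certificate `β` on a finite-codimension complement, give
`ε_sector(c) ≥ λ`.  Its instantiation on the windowed Weil form needs the CLOSED form
`E(f, h) = P(f, h) + 𝓔_c(f, h) − M_c⟨f, h⟩` (`weilPoleForm₂`, `weilDirichletEnergy₂` of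
`Theorems/OddSectorOddOneSignedWindowsLayerDefs`, Bombieri's Markov decomposition polarised) as a genuine
symmetric BILINEAR form on the finite-energy window class
`D_c = {f ∈ L² : f = 0 off [-c, c], ∫₀^∞ ρ(t) D_t(f) dt < ∞}`.  The increments and energies are in the sibling
`Theorems/GroundBartaEvenWinsBeyondArchDeflationIncrements.lean`; this file adds

* the pole form `P(f, h) = weilPoleForm₂ f h` and the real pairing `⟨f, h⟩ = ∫ Re(f h̄)`: symmetry, additivity and
  real homogeneity in the first slot, polarisation `P(f + h) = P(f) + P(h) + 2P(f, h)`, `P(a • f) = a² P(f)`;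
* the closed form: diagonal `E(f, f) = P(f) + 𝓔_c(f) − M_c ∫|f|²` (`= Re Q(f)` on smooth window tests, Bombieri's
  Markov decomposition), symmetry, additivity and real homogeneity in the first slot.  Prover B, speedrun unit `sr-gb-rung-b` (gen 3).

References: E. Bombieri, Rend. Mat. Acc. Lincei (9) 11 (2000) 183–233, Thm 2 and §4; A. Weinstein,
W. Stenger, *Methods of Intermediate Problems for Eigenvalues* (1972) Ch. 5 §9; M. Fukushima, Y. Oshima,
M. Takeda, *Dirichlet Forms and Symmetric Markov Processes* (2011) §1.1.
-/

set_option linter.dupNamespace false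

noncomputable section

open MeasureTheory Set Filter
open scoped Topology ENNReal NNReal ComplexConjugate

namespace Summit.RiemannHypothesis.RiemannHypothesis.Theorems.EvenWinsBeyondArch

open Literature.NumberTheory.LFunctions Literature.NumberTheory.LFunctions.ConnesVanSuijlekom
open Summit.RiemannHypothesis.RiemannHypothesis.Theorems.OddSector
  (weilIncrement₂ weilDirichletEnergy₂ weilPoleForm₂ weilIncrement₂_self weilDirichletEnergy₂_self
    weilPoleForm₂_self re_mul_conj_self)

variable {f g h f₁ f₂ : ℝ → ℂ} {c : ℝ}

/-! ## The polarised pole form `P(f, h)` and the real pairing `⟨f, h⟩ = ∫ Re(f h̄)` -/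

/-- Symmetry of the polarised pole form. -/
theorem dt_weilPoleForm₂_comm (f h : ℝ → ℂ) : weilPoleForm₂ f h = weilPoleForm₂ h f := by
  unfold weilPoleForm₂
  simp only [Complex.mul_re, Complex.conj_re, Complex.conj_im]
  ring

/-- **Additivity of `P(·, h)`** for window `L²` functions. -/
theorem dt_weilPoleForm₂_add_left {a : ℝ} (hf₁ : MemLp f₁ 2) (hf₂ : MemLp f₂ 2)
    (h₁ : ∀ x, x ∉ Icc (-a) a → f₁ x = 0) (h₂ : ∀ x, x ∉ Icc (-a) a → f₂ x = 0) (h : ℝ → ℂ) :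
    weilPoleForm₂ (f₁ + f₂) h = weilPoleForm₂ f₁ h + weilPoleForm₂ f₂ h := by
  have ic₁ := dt_integrable_mul_continuous hf₁ h₁ (φ := fun x ↦ (Real.cosh (x / 2) : ℂ)) (by fun_prop)
  have ic₂ := dt_integrable_mul_continuous hf₂ h₂ (φ := fun x ↦ (Real.cosh (x / 2) : ℂ)) (by fun_prop)
  have is₁ := dt_integrable_mul_continuous hf₁ h₁ (φ := fun x ↦ (Real.sinh (x / 2) : ℂ)) (by fun_prop)
  have is₂ := dt_integrable_mul_continuous hf₂ h₂ (φ := fun x ↦ (Real.sinh (x / 2) : ℂ)) (by fun_prop)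
  unfold weilPoleForm₂
  simp only [Pi.add_apply, add_mul]
  rw [integral_add ic₁ ic₂, integral_add is₁ is₂]
  simp only [add_mul, Complex.add_re]
  ring

/-- **Real homogeneity of `P(·, h)`**. -/
theorem dt_weilPoleForm₂_smul_left (a : ℝ) (f h : ℝ → ℂ) :
    weilPoleForm₂ (a • f) h = a * weilPoleForm₂ f h := by
  unfold weilPoleForm₂
  simp only [dt_smul_apply, mul_assoc, integral_const_mul, Complex.re_ofReal_mul]
  ring

/-- **Polarisation of the pole form**: `P(f + h) = P(f) + P(h) + 2 P(f, h)` for window `L²` functions. -/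
theorem dt_weilPoleForm_add {a : ℝ} (hf : MemLp f 2) (hh : MemLp h 2)
    (hf0 : ∀ x, x ∉ Icc (-a) a → f x = 0) (hh0 : ∀ x, x ∉ Icc (-a) a → h x = 0) :
    weilPoleForm (f + h) = weilPoleForm f + weilPoleForm h + 2 * weilPoleForm₂ f h := by
  have icf := dt_integrable_mul_continuous hf hf0 (φ := fun x ↦ (Real.cosh (x / 2) : ℂ)) (by fun_prop)
  have ich := dt_integrable_mul_continuous hh hh0 (φ := fun x ↦ (Real.cosh (x / 2) : ℂ)) (by fun_prop)
  have isf := dt_integrable_mul_continuous hf hf0 (φ := fun x ↦ (Real.sinh (x / 2) : ℂ)) (by fun_prop)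
  have ish := dt_integrable_mul_continuous hh hh0 (φ := fun x ↦ (Real.sinh (x / 2) : ℂ)) (by fun_prop)
  unfold weilPoleForm weilPoleForm₂
  simp only [Pi.add_apply, add_mul]
  rw [integral_add icf ich, integral_add isf ish, dt_norm_add_sq, dt_norm_add_sq]
  ring

/-- `P(a • f) = a² P(f)` for real `a`. -/
theorem dt_weilPoleForm_smul (a : ℝ) (f : ℝ → ℂ) : weilPoleForm (a • f) = a ^ 2 * weilPoleForm f := by
  unfold weilPoleForm
  simp only [dt_smul_apply, mul_assoc, integral_const_mul, norm_mul, Complex.norm_real,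
    Real.norm_eq_abs, mul_pow, sq_abs]
  ring

/-- Symmetry of the real pairing: `∫ Re(f h̄) = ∫ Re(h f̄)`. -/
theorem dt_pairing_comm (f h : ℝ → ℂ) :
    ∫ x, (f x * conj (h x)).re = ∫ x, (h x * conj (f x)).re := by
  congr 1 with x
  simp only [Complex.mul_re, Complex.conj_re, Complex.conj_im]
  ring

/-- Additivity of the real pairing in the first slot (`L²` data). -/
theorem dt_pairing_add_left (hf₁ : MemLp f₁ 2) (hf₂ : MemLp f₂ 2) (hh : MemLp h 2) :
    ∫ x, ((f₁ + f₂) x * conj (h x)).re =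
      (∫ x, (f₁ x * conj (h x)).re) + ∫ x, (f₂ x * conj (h x)).re := by
  rw [← integral_add (dt_integrable_mul_conj_re hf₁ hh) (dt_integrable_mul_conj_re hf₂ hh)]
  congr 1 with x
  simp only [Pi.add_apply, add_mul, Complex.add_re]

/-- Real homogeneity of the real pairing in the first slot. -/
theorem dt_pairing_smul_left (a : ℝ) (f h : ℝ → ℂ) :
    ∫ x, ((a • f) x * conj (h x)).re = a * ∫ x, (f x * conj (h x)).re := by
  rw [← integral_const_mul]
  congr 1 with x
  rw [dt_smul_apply, mul_assoc, Complex.re_ofReal_mul]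

/-- On the diagonal the real pairing is the squared `L²` norm. -/
theorem dt_pairing_self (f : ℝ → ℂ) : ∫ x, (f x * conj (f x)).re = ∫ x, ‖f x‖ ^ 2 := by
  congr 1 with x
  exact re_mul_conj_self _

/-- The real pairing is positive semidefinite. -/
theorem dt_pairing_self_nonneg (f : ℝ → ℂ) : 0 ≤ ∫ x, (f x * conj (f x)).re := by
  rw [dt_pairing_self]
  exact integral_nonneg fun _ ↦ by positivity

/-- `∫ ‖a • f‖² = a² ∫‖f‖²` for real `a`. -/
theorem dt_integral_norm_sq_smul (a : ℝ) (f : ℝ → ℂ) :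
    ∫ x, ‖(a • f) x‖ ^ 2 = a ^ 2 * ∫ x, ‖f x‖ ^ 2 := by
  rw [← integral_const_mul]
  congr 1 with x
  rw [dt_smul_apply, norm_mul, Complex.norm_real, Real.norm_eq_abs, mul_pow, sq_abs]

/-! ## The closed form `E_c(f, h) = P(f, h) + 𝓔_c(f, h) − M_c ⟨f, h⟩` -/

/-- **The diagonal of the polarised closed form** is Bombieri's Markov-decomposed quadratic form:
`P(f, f) + 𝓔_c(f, f) − M_c ∫ Re(f f̄) = P(f) + 𝓔_c(f) − M_c ∫|f|²`. -/
theorem dt_closedForm_self (c : ℝ) (f : ℝ → ℂ) :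
    weilPoleForm₂ f f + weilDirichletEnergy₂ c f f - weilMarkovConstant c * ∫ x, (f x * conj (f x)).re =
      weilPoleForm f + weilDirichletEnergy c f - weilMarkovConstant c * ∫ x, ‖f x‖ ^ 2 := by
  rw [weilPoleForm₂_self, weilDirichletEnergy₂_self, dt_pairing_self]

/-- For a smooth test function supported in the window the diagonal is `Re Q`:
`P(g, g) + 𝓔_c(g, g) − M_c ∫ Re(g ḡ) = Re Q(g)` (Bombieri's Markov decomposition,
`weilQuadratic_re_eq_weilPoleForm_add_weilDirichletEnergy_sub`). -/
theorem dt_closedForm_self_eq_weilQuadratic_re (hg : IsWeilTest g) (hgs : tsupport g ⊆ Icc (-c) c) :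
    weilPoleForm₂ g g + weilDirichletEnergy₂ c g g - weilMarkovConstant c * ∫ x, (g x * conj (g x)).re =
      (weilQuadratic g).re := by
  rw [dt_closedForm_self, weilQuadratic_re_eq_weilPoleForm_add_weilDirichletEnergy_sub hg hgs]

/-- **Symmetry of the closed form.** -/
theorem dt_closedForm_comm (c : ℝ) (f h : ℝ → ℂ) :
    weilPoleForm₂ f h + weilDirichletEnergy₂ c f h - weilMarkovConstant c * ∫ x, (f x * conj (h x)).re =
      weilPoleForm₂ h f + weilDirichletEnergy₂ c h f -
        weilMarkovConstant c * ∫ x, (h x * conj (f x)).re := by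
  rw [dt_weilPoleForm₂_comm, dt_weilDirichletEnergy₂_comm, dt_pairing_comm]

/-- **Additivity of the closed form in the first slot** on the finite-energy window class. -/
theorem dt_closedForm_add_left {a : ℝ} (c : ℝ) (hf₁ : MemLp f₁ 2) (hf₂ : MemLp f₂ 2) (hh : MemLp h 2)
    (h₁ : ∀ x, x ∉ Icc (-a) a → f₁ x = 0) (h₂ : ∀ x, x ∉ Icc (-a) a → f₂ x = 0)
    (hE₁ : IntegrableOn (fun t ↦ weilArchDensity t * weilIncrement f₁ t) (Ioi 0))
    (hE₂ : IntegrableOn (fun t ↦ weilArchDensity t * weilIncrement f₂ t) (Ioi 0))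
    (hEh : IntegrableOn (fun t ↦ weilArchDensity t * weilIncrement h t) (Ioi 0)) :
    weilPoleForm₂ (f₁ + f₂) h + weilDirichletEnergy₂ c (f₁ + f₂) h -
        weilMarkovConstant c * ∫ x, ((f₁ + f₂) x * conj (h x)).re =
      (weilPoleForm₂ f₁ h + weilDirichletEnergy₂ c f₁ h - weilMarkovConstant c * ∫ x, (f₁ x * conj (h x)).re) +
        (weilPoleForm₂ f₂ h + weilDirichletEnergy₂ c f₂ h -
          weilMarkovConstant c * ∫ x, (f₂ x * conj (h x)).re) := by
  rw [dt_weilPoleForm₂_add_left hf₁ hf₂ h₁ h₂, dt_weilDirichletEnergy₂_add_left c hf₁ hf₂ hh hE₁ hE₂ hEh,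
    dt_pairing_add_left hf₁ hf₂ hh]
  ring

/-- **Real homogeneity of the closed form in the first slot.** -/
theorem dt_closedForm_smul_left (c a : ℝ) (f h : ℝ → ℂ) :
    weilPoleForm₂ (a • f) h + weilDirichletEnergy₂ c (a • f) h -
        weilMarkovConstant c * ∫ x, ((a • f) x * conj (h x)).re =
      a * (weilPoleForm₂ f h + weilDirichletEnergy₂ c f h -
        weilMarkovConstant c * ∫ x, (f x * conj (h x)).re) := by
  rw [dt_weilPoleForm₂_smul_left, dt_weilDirichletEnergy₂_smul_left, dt_pairing_smul_left]
  ring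

end Summit.RiemannHypothesis.RiemannHypothesis.Theorems.EvenWinsBeyondArch

end
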